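import Literature.NumberTheory.EllipticCurves.Kato2004.IwasawaH1CoeffTorsionFreeProofs
import Literature.NumberTheory.EllipticCurves.Kato2004.IwasawaCohomologyCoeffRigidityProofs
import Literature.NumberTheory.GaloisRepresentations.ContinuousCorestrictionResNormal
import HarnessLib

/-!
# Kato 2004 (Astérisque 295) Thm. 12.4 (2) with coefficients, the `Λ`-part — the cochain ENGINE along
# the `ℤ_p`-tower: bounded torsion, `res ∘ Cor` on fixed classes, and "approximate coboundaries are
# coboundaries", when `(T ⊗ ℚ/T)^{Gal(ℚ̄/ℚ_∞)}` has bounded exponent (proofs only)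

Topic `NumberTheory/EllipticCurves`, sub-directory `Kato2004` (namespace = path).  THEOREMS ONLY.  Third
file of seat `bsd-wall-tp2-p2x-w2` g23 on the print leaf K0b (`Kato2004.thm12_4_newform`, clause
"`𝐇¹(T)` is a torsion free `Λ`-module"), after `IwasawaH1CoeffTorsionFreeProofs` (constant part,
unconditional) and `IwasawaCohomologyCoeffRigidityProofs` (the forced level-`n` action).  For a
continuous `T : Γ_ℚ → Aut_A(M)`, a `ℤ_p`-extension `κ` (layers `Γ_n`, kernel `Γ_∞ = Gal(ℚ̄/ℚ_∞)`) and
ANY pin `I : IwasawaH1DataCoeff T p κ γ`, under the element-wise hypothesis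
  (HYP_J) every `m ∈ M` fixed by `Γ_∞` modulo `p^{j+J} M` lies in `p^j M` — i.e. `(M ⊗ ℚ/M)^{Γ_∞}` is
  killed by `p^J`; for a lattice in `V_{F_λ}(g)(1)` this is "no `Γ_∞`-fixed line" (Kato (14.10.5)) —
we prove: §A bounded torsion (`p^k`-torsion classes of `H¹(ℚ_n, T)` are `p^J`-torsion); §C for a
norm-compatible family of `Γ_n`-fixed classes `res_{n→m} x_n = p^{m−n} x_m` (`res ∘ cor = Σ conj`);
§D the key step (`c ≡ ∂b` modulo `a` on a normal `H ≤ H'` ⟹ each `c(g) − (gb − b)` is `H`-fixed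
modulo `a`); §E approximate coboundaries are coboundaries (with `p`-adic precompleteness and
separatedness of `M`, element-wise), and the tower supplies the approximations.  The sibling file
`IwasawaH1CoeffLambdaTorsionProofs` concludes ON THE PIN: no `ω_j`-torsion, no torsion by polynomials
`P` with a power of `p` in every `(P, ω_n)`.

HONEST FRAMING: the two halves of the `Λ`-torsion statement of Thm. 12.4 (2), CONDITIONAL on (HYP_J)
(plus Noetherian / embedding / completeness side conditions, all true for `𝒪_λⁿ`); the assembly over
`Λ_𝒪 = 𝒪⟦X⟧` (Weierstrass preparation, cyclotomic factors, resultants) is a sibling file;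
`thm12_4_newform` stays a named fact and (HYP_J) for `T_ρ` is PRINT (purity / irreducibility of `V_g`).
Kato's §13.8 goes through `𝐇¹ ≅ H¹(ℤ[1/p], T ⊗ Λ)`; the levelwise route here is Perrin-Riou's.  BSD is
not advanced by this file.

## References

* [Kato2004Asterisque] K. Kato, Astérisque 295 (2004): Thm. 12.4 (2) (p. 221), §13.8 (pp. 228–229),
  (14.10.5) (p. 241).
* [NeukirchSchmidtWingberg2008] Neukirch–Schmidt–Wingberg, *Cohomology of Number Fields*, I §5
  (1.5.6)–(1.5.7) (`res ∘ cor`).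
* [SerreGaloisCohomology1997] J.-P. Serre, *Galois Cohomology*, I §2.2–2.4.
-/

noncomputable section

open scoped NumberField
open Field CategoryTheory Topology Polynomial
open Literature.NumberTheory.GaloisRepresentations
open Literature.NumberTheory.EllipticCurves Literature.NumberTheory.EllipticCurves.Kato2004
open Literature.NumberTheory.EllipticCurves.Kato2004.EulerSystemValues

namespace Literature.NumberTheory.EllipticCurves.Kato2004

namespace IwasawaH1CoeffTorsionFree

section Tower

variable {A : Type} [CommRing A] [TopologicalSpace A] {M : Type} [AddCommGroup M] [Module A M]
  [TopologicalSpace M] [IsTopologicalAddGroup M] [ContinuousSMul A M]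
  (T : GaloisRep ℚ A M) {p : ℕ} [Fact p.Prime] (κ : ZpExtension ℚ p)

/-- `Γ_n = ⋃_i γ^{p^n i} Γ_m` for `n ≤ m`: every `g ∈ κ⁻¹(p^n ℤ_p)` is `γ^{p^n i} h` with `h ∈ κ⁻¹(p^m ℤ_p)`
(`κ γ = 1`; `p`-adic approximation `PadicInt.appr`). [cite: NeukirchSchmidtWingberg2008, I §5 (1.5.7)] -/
theorem exists_pow_mul_of_mem_layerSubgroup {γ : absoluteGaloisGroup ℚ} (hγ : κ.IsTopGenerator γ)
    {n m : ℕ} (hnm : n ≤ m) {g : absoluteGaloisGroup ℚ} (hg : g ∈ κ.layerSubgroup n) :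
    ∃ (i : ℕ) (h : absoluteGaloisGroup ℚ), h ∈ κ.layerSubgroup m ∧ g = γ ^ (p ^ n * i) * h := by
  have hγ' : κ γ = Multiplicative.ofAdd 1 := hγ
  obtain ⟨a, ha⟩ := ZpExtension.mem_layerSubgroup.mp hg
  refine ⟨PadicInt.appr a (m - n), (γ ^ (p ^ n * PadicInt.appr a (m - n)))⁻¹ * g, ?_,
    by rw [mul_inv_cancel_left]⟩
  rw [ZpExtension.mem_layerSubgroup, map_mul, map_inv, map_pow, hγ', toAdd_mul, toAdd_inv,
    ← ofAdd_nsmul, toAdd_ofAdd, nsmul_eq_mul, mul_one, ha]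
  obtain ⟨b, hb⟩ := Ideal.mem_span_singleton.mp (PadicInt.appr_spec (m - n) a)
  refine ⟨b, ?_⟩
  rw [Nat.cast_mul, Nat.cast_pow, neg_add_eq_sub, ← mul_sub, hb, ← mul_assoc, ← pow_add,
    Nat.add_sub_cancel' hnm]

/-- **Bounded torsion under (HYP_J).**  If `m ∈ M` fixed by `Γ_∞` modulo `a^{j+J}` lies in `a^j M` for all
`j, m` (and the `a^k` act injectively), then every `a^k`-torsion class `y ∈ H¹(ℚ_n, T)` is `a^J`-torsion:
`a^k c = ∂m` with `m` fixed modulo `a^k` by `Γ_n ⊇ Γ_∞`, so `m = a^{k−J} m'` and `a^J c = ∂m'`.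
[cite: Kato2004Asterisque, §13.8 (pp. 228–229)] -/
theorem pow_smul_eq_zero_of_pow_smul_eq_zero (a : A) (J : ℕ)
    (hinj : ∀ k : ℕ, Function.Injective fun v : M ↦ a ^ k • v)
    (hJ : ∀ (j : ℕ) (m : M), (∀ g ∈ κ.kerSubgroup, ∃ t : M, a ^ (j + J) • t = T g m - m) →
      ∃ t : M, a ^ j • t = m)
    (n k : ℕ) (y : H1 T (κ.layerSubgroup n)) (hy : a ^ k • y = 0) : a ^ J • y = 0 := by
  have hρ : ∀ (g : κ.layerSubgroup n) (v : M),
      (subgroupRep T.toTopRep (κ.layerSubgroup n)).ρ g v = T (g : absoluteGaloisGroup ℚ) v :=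
    fun _ _ ↦ rfl
  rcases le_or_gt k J with hkJ | hJk
  · rw [← Nat.add_sub_cancel' hkJ, pow_add, mul_comm, mul_smul, hy, smul_zero]
  -- `a^k • c = ∂m` with `m` fixed modulo `a^k` by `Γ_n ⊇ Γ_∞`
  obtain ⟨c, rfl⟩ := oneCocycleClass_surjective _ y
  rw [← oneCocycleClass_smul, oneCocycleClass_eq_zero_iff] at hy
  obtain ⟨m, hm⟩ := hy
  have hm' : ∀ g : κ.layerSubgroup n, a ^ k • c.1 g = T (g : absoluteGaloisGroup ℚ) m - m :=
    fun g ↦ by rw [← hρ, ← hm g, Submodule.coe_smul, ContinuousMap.smul_apply]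
  obtain ⟨j, rfl⟩ : ∃ j, k = j + J := ⟨k - J, (Nat.sub_add_cancel hJk.le).symm⟩
  -- HYP: `m = a^j • m'`
  obtain ⟨m', hm'eq⟩ := hJ j m fun g hg ↦
    ⟨c.1 ⟨g, κ.kerSubgroup_le_layerSubgroup n hg⟩, hm' ⟨g, _⟩⟩
  -- `a^J • c = ∂m'` after cancelling `a^j`
  rw [← oneCocycleClass_smul, oneCocycleClass_eq_zero_iff]
  refine ⟨m', fun g ↦ hinj j ?_⟩
  change a ^ j • (a ^ J • c).1 g = a ^ j • ((subgroupRep T.toTopRep (κ.layerSubgroup n)).ρ g m' - m')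
  rw [Submodule.coe_smul, ContinuousMap.smul_apply, smul_smul, ← pow_add, hm', hρ, smul_sub,
    ← map_smul, hm'eq]

/-! ## §C Classes fixed by the Galois group of a lower layer -/

/-- A class of `H¹(ℚ_m, T)` fixed by `conj_{γ^{p^n}}` (`n ≤ m`) is fixed by `conj_g` for every `g ∈ Γ_n`
(`g = γ^{p^n i} h`, `h ∈ Γ_m` acts trivially). [cite: NeukirchSchmidtWingberg2008, I §5 (1.5.7)] -/
theorem conjMap_eq_self_of_pow {γ : absoluteGaloisGroup ℚ} (hγ : κ.IsTopGenerator γ)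
    {n m : ℕ} (hnm : n ≤ m) (y : H1 T (κ.layerSubgroup m))
    (hy : conjMap T.toTopRep (κ.layerSubgroup m) (γ ^ p ^ n) 1 y = y)
    {g : absoluteGaloisGroup ℚ} (hg : g ∈ κ.layerSubgroup n) :
    conjMap T.toTopRep (κ.layerSubgroup m) g 1 y = y := by
  obtain ⟨i, h, hh, rfl⟩ := exists_pow_mul_of_mem_layerSubgroup κ hγ hnm hg
  clear hg
  rw [conjMap_mul_apply_one, conjMap_one_apply_of_mem T.toTopRep _ ⟨h, hh⟩, pow_mul]
  induction i with
  | zero => rw [pow_zero]; exact conjMap_one_apply_of_mem T.toTopRep _ (1 : κ.layerSubgroup m) y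
  | succ i ih => rw [pow_succ, conjMap_mul_apply_one, hy, ih]

/-- **`res ∘ Cor = p` on `Γ_n`-fixed classes:** for `y ∈ H¹(ℚ_{n+1}, T)` fixed by `conj_g`, `g ∈ Γ_n`,
`res_{n→n+1}(Cor y) = Σ_{Γ_n/Γ_{n+1}} conj_s y = p • y` (`resLe_coresLe_eq_sum_conjMap`,
`(Γ_n : Γ_{n+1}) = p`). [cite: NeukirchSchmidtWingberg2008, I §5 (1.5.6)–(1.5.7)] -/
theorem resLe_layerCores_eq_smul_of_invariant (n : ℕ) (y : H1 T (κ.layerSubgroup (n + 1)))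
    (hy : ∀ g ∈ κ.layerSubgroup n, conjMap T.toTopRep (κ.layerSubgroup (n + 1)) g 1 y = y) :
    resLe T.toTopRep (κ.layerSubgroup_antitone (Nat.le_succ n)) 1 (layerCores T κ n y) =
      (p : A) • y := by
  have hp : p.Prime := Fact.out
  have hle : κ.layerSubgroup (n + 1) ≤ κ.layerSubgroup n := κ.layerSubgroup_antitone (Nat.le_succ n)
  letI : (κ.layerSubgroup (n + 1)).FiniteIndex :=
    finiteIndex_of_isOpen_of_compactSpace _ (κ.isOpen_layerSubgroup (n + 1))
  letI : Fintype (κ.layerSubgroup n ⧸ (κ.layerSubgroup (n + 1)).subgroupOf (κ.layerSubgroup n)) :=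
    Fintype.ofFinite _
  have hidx : ((κ.layerSubgroup (n + 1)).subgroupOf (κ.layerSubgroup n)).index = p := by
    have h1 := Subgroup.relIndex_mul_index hle
    rw [ZpExtension.index_layerSubgroup, ZpExtension.index_layerSubgroup, pow_succ'] at h1
    exact Nat.eq_of_mul_eq_mul_right (pow_pos hp.pos n) h1
  have hs : ∀ x : κ.layerSubgroup n ⧸ (κ.layerSubgroup (n + 1)).subgroupOf (κ.layerSubgroup n),
      ((Quotient.out x : κ.layerSubgroup n) : _ ⧸ _) = x := fun x ↦ QuotientGroup.out_eq' x
  unfold layerCores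
  rw [resLe_coresLe_eq_sum_conjMap T.toTopRep hle (κ.isOpen_layerSubgroup (n + 1)) hs,
    Finset.sum_congr rfl fun x _ ↦ hy _ (Quotient.out x).2, Finset.sum_const, Finset.card_univ,
    ← Nat.card_eq_fintype_card, ← Subgroup.index_eq_card, hidx, Nat.cast_smul_eq_nsmul]

/-- Two restrictions compose (local copy of `resLe_resLe_apply`). [cite: SerreGaloisCohomology1997, I §2.4] -/
private theorem resLe_resLe {H H' H'' : Subgroup (absoluteGaloisGroup ℚ)} (h : H ≤ H') (h' : H' ≤ H'')
    (c : continuousCohomology 1 (subgroupRep T.toTopRep H'')) :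
    resLe T.toTopRep h 1 (resLe T.toTopRep h' 1 c) = resLe T.toTopRep (h.trans h') 1 c := by
  obtain ⟨ψ, rfl⟩ := oneCocycleClass_surjective _ c
  rw [resLe_oneCocycleClass, resLe_oneCocycleClass, resLe_oneCocycleClass]
  exact congrArg _ (Subtype.ext (ContinuousMap.ext fun _ => rfl))

/-- **`res_{n→m} x_n = p^{m−n} x_m`** for a norm-compatible family `(x_k)` (`Cor x_{k+1} = x_k`) whose
members of level `≥ n` are fixed by `Γ_n` (induction on `m` with `resLe_layerCores_eq_smul_of_invariant`).
[cite: NeukirchSchmidtWingberg2008, I §5 (1.5.6)–(1.5.7)] -/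
theorem resLe_eq_pow_smul_of_invariant (x : ∀ k : ℕ, H1 T (κ.layerSubgroup k))
    (hcores : ∀ k, layerCores T κ k (x (k + 1)) = x k) (n : ℕ)
    (hinv : ∀ k, n ≤ k → ∀ g ∈ κ.layerSubgroup n, conjMap T.toTopRep (κ.layerSubgroup k) g 1 (x k) = x k)
    (m : ℕ) (hnm : n ≤ m) :
    resLe T.toTopRep (κ.layerSubgroup_antitone hnm) 1 (x n) = (p : A) ^ (m - n) • x m := by
  induction m, hnm using Nat.le_induction with
  | base =>
    rw [Nat.sub_self, pow_zero, one_smul]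
    obtain ⟨ψ, hψ⟩ := oneCocycleClass_surjective _ (x n)
    rw [← hψ, resLe_oneCocycleClass]
    exact congrArg _ (Subtype.ext (ContinuousMap.ext fun _ => rfl))
  | succ m hnm ih =>
    rw [← resLe_resLe T (κ.layerSubgroup_antitone (Nat.le_succ m)) (κ.layerSubgroup_antitone hnm), ih,
      map_smul, ← hcores m, resLe_layerCores_eq_smul_of_invariant T κ m (x (m + 1))
        (fun g hg ↦ hinv (m + 1) (hnm.trans (Nat.le_succ m)) g (κ.layerSubgroup_antitone hnm hg)),
      smul_smul, ← pow_succ, Nat.sub_add_comm hnm]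

/-! ## §D Cochain extraction and the key algebraic step -/

/-- Cochain form of `res [c] = a • [c']`: `c|_H − a c' = ∂b` for some `b ∈ M`.
[cite: SerreGaloisCohomology1997, I §2.2] -/
theorem exists_sub_smul_eq_coboundary {H H' : Subgroup (absoluteGaloisGroup ℚ)} (hle : H ≤ H')
    (c : contOneCocycles (subgroupRep T.toTopRep H')) (c' : contOneCocycles (subgroupRep T.toTopRep H))
    (a : A) (h : resLe T.toTopRep hle 1 (oneCocycleClass _ c) = a • oneCocycleClass _ c') :
    ∃ b : M, ∀ g : H, c.1 (subgroupInclusion hle g) - a • c'.1 g = T (g : absoluteGaloisGroup ℚ) b - b := by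
  rw [resLe_oneCocycleClass, ← oneCocycleClass_smul, ← sub_eq_zero, ← oneCocycleClass_sub,
    oneCocycleClass_eq_zero_iff] at h
  obtain ⟨b, hb⟩ := h
  exact ⟨b, fun g ↦ hb g⟩

/-- **Key step.**  If a cocycle `c` on `H'` satisfies `c ≡ ∂b (mod a • M)` on a subgroup `H ≤ H'` NORMAL
in `Γ_ℚ`, then for every `g ∈ H'` the element `u_g = c(g) − (g b − b)` is `H`-fixed modulo `a • M`:
comparing the expansions of `c(h g) = c(g · g⁻¹hg)` gives `(h − 1) u_g = a (g t₂ − t₁)` (the cochain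
shadow of inflation–restriction for `H ⊴ H'`). [cite: SerreGaloisCohomology1997, I §2.2] -/
theorem exists_smul_eq_conj_sub_of_coboundary_mod {H H' : Subgroup (absoluteGaloisGroup ℚ)} [H.Normal]
    (hle : H ≤ H') (c : contOneCocycles (subgroupRep T.toTopRep H')) (b : M) (a : A)
    (hc : ∀ h : H, ∃ t : M, a • t =
      c.1 (subgroupInclusion hle h) - (T (h : absoluteGaloisGroup ℚ) b - b))
    (g : H') {h : absoluteGaloisGroup ℚ} (hh : h ∈ H) :
    ∃ t : M, a • t = T h (c.1 g - (T (g : absoluteGaloisGroup ℚ) b - b)) -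
      (c.1 g - (T (g : absoluteGaloisGroup ℚ) b - b)) := by
  have hρ : ∀ (x : H') (v : M), (subgroupRep T.toTopRep H').ρ x v = T (x : absoluteGaloisGroup ℚ) v :=
    fun _ _ ↦ rfl
  -- `h' = g⁻¹ h g ∈ H`, and `h g = g h'` in `H'`
  have hh' : (g : absoluteGaloisGroup ℚ)⁻¹ * h * g ∈ H := by
    have := ‹H.Normal›.conj_mem h hh (g : absoluteGaloisGroup ℚ)⁻¹
    rwa [inv_inv] at this
  set hH : H' := ⟨h, hle hh⟩ with hhH
  set h'H : H' := ⟨(g : absoluteGaloisGroup ℚ)⁻¹ * h * g, hle hh'⟩ with hh'H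
  have hcomm : hH * g = g * h'H := Subtype.ext (by simp [hhH, hh'H, mul_assoc])
  -- the two expansions of `c(h g) = c(g h')`
  have h1 := c.2 hH g
  have h2 := c.2 g h'H
  rw [hcomm, h2, hρ, hρ] at h1
  -- `c(h) ≡ h b - b`, `c(h') ≡ h' b - b` modulo `a`
  obtain ⟨t₁, ht₁⟩ := hc ⟨h, hh⟩
  obtain ⟨t₂, ht₂⟩ := hc ⟨_, hh'⟩
  have ht₁' : a • t₁ = c.1 hH - (T h b - b) := ht₁
  have ht₂' : a • t₂ = c.1 h'H - (T ((g : absoluteGaloisGroup ℚ)⁻¹ * h * g) b - b) := ht₂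
  have e₁ : c.1 hH = a • t₁ + (T h b - b) := by rw [ht₁', sub_add_cancel]
  have e₂ : c.1 h'H = a • t₂ + (T ((g : absoluteGaloisGroup ℚ)⁻¹ * h * g) b - b) := by
    rw [ht₂', sub_add_cancel]
  -- `T g (T (g⁻¹ h g) b) = T h (T g b)`
  have hT : T (g : absoluteGaloisGroup ℚ) (T ((g : absoluteGaloisGroup ℚ)⁻¹ * h * g) b) =
      T h (T (g : absoluteGaloisGroup ℚ) b) := by
    rw [← Module.End.mul_apply, ← map_mul, ← Module.End.mul_apply, ← map_mul]
    congr 2; group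
  have h1' : T h (c.1 g) = c.1 g + T (g : absoluteGaloisGroup ℚ) (c.1 h'H) - c.1 hH := by
    rw [eq_sub_iff_add_eq, add_comm]; exact h1.symm
  refine ⟨T (g : absoluteGaloisGroup ℚ) t₂ - t₁, ?_⟩
  rw [map_sub (T h), map_sub (T h), h1', e₁, e₂, map_add, map_sub, map_smul, hT, smul_sub]
  abel

end Tower

/-! ## §E Approximate coboundaries are coboundaries; the cyclotomic case -/

section Cyclotomic

variable {A : Type} [CommRing A] [TopologicalSpace A] {M : Type} [AddCommGroup M] [Module A M]
  [TopologicalSpace M] [IsTopologicalAddGroup M] [ContinuousSMul A M]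
  (T : GaloisRep ℚ A M) {p : ℕ} [Fact p.Prime] (κ : ZpExtension ℚ p)

/-- **Approximate coboundaries are coboundaries.**  Under (HYP_J), `p`-adic precompleteness of `M`
(`hprec`: a sequence with `f(k+1) − f(k) ∈ p^k M` has a limit `L`, `f(k) − L ∈ p^k M`) and separatedness
(`hhaus`: `⋂_k p^k M = 0`), a continuous cocycle `c` on `Γ_n` with `c ≡ ∂b_e (mod p^e M)` for every `e`
is a coboundary: `b_{e+1} − b_e` is `Γ_n`-fixed modulo `p^e`, so in `p^{e−J}M` by (HYP); the `b_{j+J}`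
converge to `L` and `c = ∂L`. [cite: SerreGaloisCohomology1997, I §2.2] -/
theorem oneCocycleClass_eq_zero_of_forall_approx (J : ℕ)
    (hJ : ∀ (j : ℕ) (m : M), (∀ g ∈ κ.kerSubgroup, ∃ t : M, (p : A) ^ (j + J) • t = T g m - m) →
      ∃ t : M, (p : A) ^ j • t = m)
    (hprec : ∀ f : ℕ → M, (∀ k, ∃ t : M, (p : A) ^ k • t = f (k + 1) - f k) →
      ∃ L : M, ∀ k, ∃ t : M, (p : A) ^ k • t = f k - L)
    (hhaus : ∀ m : M, (∀ k, ∃ t : M, (p : A) ^ k • t = m) → m = 0)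
    (n : ℕ) (c : contOneCocycles (subgroupRep T.toTopRep (κ.layerSubgroup n)))
    (happrox : ∀ e : ℕ, ∃ b : M, ∀ g : κ.layerSubgroup n, ∃ t : M,
      (p : A) ^ e • t = c.1 g - (T (g : absoluteGaloisGroup ℚ) b - b)) :
    oneCocycleClass _ c = 0 := by
  choose b hb using happrox
  -- consecutive `b`'s differ by elements fixed modulo `p^e`, hence (HYP) by multiples of `p^{e-J}`
  have hdiff : ∀ j, ∃ t : M, (p : A) ^ j • t = b (j + J + 1) - b (j + J) := by
    intro j
    refine hJ j _ fun g hg ↦ ?_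
    obtain ⟨t₁, ht₁⟩ := hb (j + J) ⟨g, κ.kerSubgroup_le_layerSubgroup n hg⟩
    obtain ⟨t₂, ht₂⟩ := hb (j + J + 1) ⟨g, κ.kerSubgroup_le_layerSubgroup n hg⟩
    refine ⟨t₁ - (p : A) • t₂, ?_⟩
    rw [smul_sub, smul_smul, ← pow_succ, ht₁, ht₂, map_sub]
    abel
  -- the limit `L` of the Cauchy sequence `j ↦ b (j + J)`
  obtain ⟨L, hL⟩ := hprec (fun j ↦ b (j + J)) fun k ↦ by
    obtain ⟨t, ht⟩ := hdiff k
    exact ⟨t, by rw [ht, Nat.add_right_comm]⟩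
  -- `c = ∂L`
  rw [oneCocycleClass_eq_zero_iff]
  refine ⟨L, fun g ↦ ?_⟩
  rw [← sub_eq_zero]
  refine hhaus _ fun k ↦ ?_
  obtain ⟨t₁, ht₁⟩ := hb (k + J) g
  obtain ⟨t₂, ht₂⟩ := hL k
  refine ⟨(p : A) ^ J • t₁ + (T (g : absoluteGaloisGroup ℚ) t₂ - t₂), ?_⟩
  rw [smul_add, smul_smul, ← pow_add, ht₁, smul_sub, ← map_smul, ht₂, map_sub]
  change _ = c.1 g - (T (g : absoluteGaloisGroup ℚ) L - L)
  abel

/-- **The tower supplies the approximations.**  For a norm-compatible family `(x_k)` fixed by `Γ_n` from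
level `n` on and a cocycle `c` representing `x_n`: for every `e`, `c ≡ ∂b (mod p^e M)` on `Γ_n` for some
`b` — restrict to level `n+e+J` (`res x_n = p^{e+J} x_{n+e+J}`, §C), read off `c ≡ ∂b (mod p^{e+J})`
there, push back to `Γ_n` by the key step (`u_g` is `Γ_∞`-fixed mod `p^{e+J}`) and (HYP_J).
[cite: Kato2004Asterisque, §13.8 (pp. 228–229)] -/
theorem exists_approx_coboundary_of_invariant (J : ℕ)
    (hJ : ∀ (j : ℕ) (m : M), (∀ g ∈ κ.kerSubgroup, ∃ t : M, (p : A) ^ (j + J) • t = T g m - m) →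
      ∃ t : M, (p : A) ^ j • t = m)
    (x : ∀ k : ℕ, H1 T (κ.layerSubgroup k)) (hcores : ∀ k, layerCores T κ k (x (k + 1)) = x k) (n : ℕ)
    (hinv : ∀ k, n ≤ k → ∀ g ∈ κ.layerSubgroup n, conjMap T.toTopRep (κ.layerSubgroup k) g 1 (x k) = x k)
    (c : contOneCocycles (subgroupRep T.toTopRep (κ.layerSubgroup n))) (hc : oneCocycleClass _ c = x n)
    (e : ℕ) :
    ∃ b : M, ∀ g : κ.layerSubgroup n, ∃ t : M,
      (p : A) ^ e • t = c.1 g - (T (g : absoluteGaloisGroup ℚ) b - b) := by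
  have hnm : n ≤ n + (e + J) := Nat.le_add_right n (e + J)
  have hle : κ.layerSubgroup (n + (e + J)) ≤ κ.layerSubgroup n := κ.layerSubgroup_antitone hnm
  -- `res_{n → n+e+J} [c] = p^{e+J} • x_{n+e+J} = p^{e+J} • [c']`
  have hres := resLe_eq_pow_smul_of_invariant T κ x hcores n hinv (n + (e + J)) hnm
  rw [Nat.add_sub_cancel_left, ← hc] at hres
  obtain ⟨c', hc'⟩ := oneCocycleClass_surjective _ (x (n + (e + J)))
  rw [← hc'] at hres
  -- `c ≡ ∂b (mod p^{e+J})` on `Γ_{n+e+J}`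
  obtain ⟨b, hb⟩ := exists_sub_smul_eq_coboundary T hle c c' _ hres
  refine ⟨b, fun g ↦ ?_⟩
  -- the key step: `u_g = c(g) − (g b − b)` is `Γ_{n+e+J}`-fixed modulo `p^{e+J}`, hence `Γ_∞`-fixed
  refine hJ e _ fun h hh ↦ ?_
  exact exists_smul_eq_conj_sub_of_coboundary_mod T hle c b ((p : A) ^ (e + J))
    (fun h ↦ ⟨c'.1 h, by rw [← hb h]; abel⟩) g
    (κ.kerSubgroup_le_layerSubgroup _ hh)

end Cyclotomic

end IwasawaH1CoeffTorsionFree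

end Literature.NumberTheory.EllipticCurves.Kato2004

end
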